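import Summits.ValiantsHypothesis.ValiantsHypothesis.Theorems.KPlusLogSqLawTropicalSymmetricThreeFourSixteen

/-!
# Route «KPlusLogSqLaw» — the SYMMETRIC `(3,4)` tropical row — exclusion lemmas W1, W2 and the PARITY lemma («Lemma Z») behind
# `T_sym(3,4) ≤ 15` (abstract, over terms of `S₃ × (Fin 3 → Fin 4)` with the pairwise exchange hypotheses and abstract sign data)

HONEST FRAMING.  Helper file (seat val-sym-lift-p2 (g6), cell `pub-symmetroid`, 2026-08-27; `--supports` the `WeakLifting` item
stmt-ValiantsHypothesis-19561 as a helper, no closure claim).  A SMALL-FORMAT statement in the single-term-carrier model, far inside the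
known regime of the cruxes; nothing here is about `TropicalB` / `WeakLifting` in their windows, Conjecture B, the real census numeral of
Door A at `(3,4)` (`PosRootLawAt 3 4 18`, OPEN, never asserted), `MatrixDescartes` (stmt-ValiantsHypothesis-18050) or VP ≠ VNP.

THIS FILE: two more abstract exclusion lemmas in the style of `SymmetricThreeFourSixteen.lemmaY1` (hypotheses = cycle-constancy `h1`,
involutive carriers `hinv`, same-row monotonicity `h2`, crossing cancellation `h6`/`h7` in `g`-form, monotonicity of `g` on occurring
classes `h8`; classes are exponent RANKS, `g` lists the exponents by rank), and the sign lemma: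
* `lemmaW1`: `{0,1,3}` and `{2,2,2}` both carried ⇒ `¬ (2·g 2 < g 0 + g 3)` (with `lemmaY2`: `{0,1,3}, {0,2,3}, {1,2,2}, {2,2,2}` are not all
  carried);
* `lemmaW2` (mirror): `{0,2,3}` and `{1,1,1}` both carried ⇒ `¬ (g 0 + g 3 < 2·g 1)` (with `lemmaY1`: `{0,1,3}, {0,2,3}, {1,1,2}, {1,1,1}`);
* `parity` («LEMMA Z»): abstract sign data `s a` (sign of the `a`-th term) and `A k c` (sign of the diagonal letter of rank `c` at column
  `k`), with `hD` (an identity term `D(u)` has sign `∏_k A k (u k)` — tree: `termSign_one_eq`), `hT` (a crossing term fixing column `k` has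
  the sign of `−A k (rank at k)` — tree: `termSign_swap_symm_three`) and alternation of consecutive signs: an identity term `D(u)`
  immediately followed by three crossing terms fixing the three columns, each with `u`'s rank at its fixed column, is impossible — the four
  signs have product `−(∏_k A k (u k))²·(…)² < 0`, while consecutive alternating signs have positive product.  This single pattern kills
  all 19 440 sign-free 17-term chains of the pairwise relaxation (seat enumeration, HOME/val-sym-lift-p2/g6/: 972 on each of 20 of the 80
  generic exponent order types), in agreement with the cell value `15` of theory-2 g19 / lift-p2 g5 (two other codes).
Together with X1/X2/Y1/Y2 and `lemmaV2` (`…FifteenExclusion`), W1/W2 complete the list of inclusion-minimal collections of ≤ 4 rank multisets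
that no symmetric single-term chain carries; they force the three missed multisets of a 17-term chain to be `{0,0,3}, {0,1,3}` and one of
`{0,3,3}/{1,2,3}` — or the mirror image — which is where `parity` bites. [cell statement R1668 «Lemma Z»; folklore-level exchange and sign
arguments, no citation exists]
-/

set_option linter.dupNamespace false
set_option autoImplicit false

namespace Summit.ValiantsHypothesis.ValiantsHypothesis.Theorems.KPlusLogSqLaw

open Summit.ValiantsHypothesis.ValiantsHypothesis.Theorems.MatrixDescartes.Negative
open Summit.ValiantsHypothesis.ValiantsHypothesis.Theorems.LacunarySymmetroidMatrixDescartes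
open Summit.ValiantsHypothesis.ValiantsHypothesis.Theorems.LacunarySymmetroidMatrixDescartes.TropicalCensus
open Finset

namespace SymmetricThreeFourFifteen

open SymmetricThreeFour SymmetricThreeFourSeventeen SymmetricThreeFourSixteen

/-! ## 1. Small facts -/

/-- class counts of the pattern vector `(2,2,2)`. -/
theorem cnt222 : ∀ l : Fin 4, (univ.filter fun i : Fin 3 => (![2, 2, 2] : Fin 3 → Fin 4) i = l).card = (![0, 0, 3, 0] : Fin 4 → ℕ) l := by
  decide
/-- class counts of the pattern vector `(1,1,1)`. -/
theorem cnt111 : ∀ l : Fin 4, (univ.filter fun i : Fin 3 => (![1, 1, 1] : Fin 3 → Fin 4) i = l).card = (![0, 3, 0, 0] : Fin 4 → ℕ) l := by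
  decide

/-- a non-identity involution of `Fin 3` has a fixed point. -/
theorem fixed_of_involutive : ∀ σ : Equiv.Perm (Fin 3), σ ≠ 1 → (∀ i, σ (σ i) = i) → ∃ k, σ k = k := by decide

/-- in `Fin 3`, an element different from `k` is one of the other two. -/
theorem eq_or_eq_of_ne_third : ∀ i j k x : Fin 3, i ≠ j → i ≠ k → j ≠ k → x ≠ k → x = i ∨ x = j := by decide

/-- `Fin 4` bookkeeping. -/
theorem f4_j : ∀ x : Fin 4, x ≠ 0 → x ≠ 1 → x ≠ 3 → x = 2 := by decide
/-- `Fin 4` bookkeeping. -/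
theorem f4_k : ∀ x : Fin 4, x ≠ 0 → x ≠ 2 → x ≠ 3 → x = 1 := by decide

/-- the carrier of a non-identity involutive term: a fixed column `k` and a swapped pair `i, j`. -/
theorem carrier_of_ne_one (σ : Equiv.Perm (Fin 3)) (hne : σ ≠ 1) (hinv : ∀ i, σ (σ i) = i) :
    ∃ k i j : Fin 3, σ k = k ∧ i ≠ j ∧ σ i = j ∧ σ j = i ∧ i ≠ k ∧ j ≠ k := by
  obtain ⟨k, hk⟩ := fixed_of_involutive σ hne hinv
  obtain ⟨i, j, hij, hi, hj, hik, hjk⟩ := moved_pair σ k hne hk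
  exact ⟨k, i, j, hk, hij, hi, hj, hik, hjk⟩

/-! ## 2. Lemma W1 / W2 -/

/-- **Lemma W1**: if `{0,1,3}` and `{2,2,2}` are both carried then `¬ (2·g 2 < g 0 + g 3)`. [exchange argument] -/
theorem lemmaW1 {n : ℕ} (r : Fin (n + 1) → Equiv.Perm (Fin 3) × (Fin 3 → Fin 4)) (g : Fin 4 → ℕ)
    (h1 : ∀ k i, (r k).2 ((r k).1 i) = (r k).2 i)
    (hinv : ∀ k i, (r k).1 ((r k).1 i) = i)
    (h2 : ∀ a b : Fin (n + 1), a < b → ∀ i, (r a).1 i = (r b).1 i → (r a).2 i ≤ (r b).2 i)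
    (h6 : ∀ a b : Fin (n + 1), a < b → (r a).1 = 1 → ∀ i j : Fin 3, i ≠ j → (r b).1 i = j → (r b).1 j = i →
      g ((r a).2 i) + g ((r a).2 j) < 2 * g ((r b).2 i))
    (h7 : ∀ a b : Fin (n + 1), a < b → (r b).1 = 1 → ∀ i j : Fin 3, i ≠ j → (r a).1 i = j → (r a).1 j = i →
      2 * g ((r a).2 i) < g ((r b).2 i) + g ((r b).2 j))
    (h8 : ∀ (a b : Fin (n + 1)) (i j : Fin 3), (r a).2 i ≤ (r b).2 j → g ((r a).2 i) ≤ g ((r b).2 j))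
    (hg : 2 * g 2 < g 0 + g 3) : ∀ a e : Fin (n + 1),
    TropicalCensus.classSym (r a) = TropicalCensus.classSym ((1 : Equiv.Perm (Fin 3)), (![0, 1, 3] : Fin 3 → Fin 4)) →
    TropicalCensus.classSym (r e) = TropicalCensus.classSym ((1 : Equiv.Perm (Fin 3)), (![2, 2, 2] : Fin 3 → Fin 4)) → False := by
  intro a e ha he
  have ca : ∀ l, (univ.filter fun i => (r a).2 i = l).card = (![1, 1, 0, 1] : Fin 4 → ℕ) l :=
    fun l => (card_filter_eq_of_classSym_eq ha l).trans (cnt013 l)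
  have ce : ∀ l, (univ.filter fun i => (r e).2 i = l).card = (![0, 0, 3, 0] : Fin 4 → ℕ) l :=
    fun l => (card_filter_eq_of_classSym_eq he l).trans (cnt222 l)
  have ha1 : (r a).1 = 1 := perm_eq_one_of_card_le_one _ (h1 a) fun l => by
    rw [ca l]; fin_cases l <;> decide
  have hae : a ≠ e := by
    intro h; have := ca 0; rw [h, ce 0] at this; exact absurd this (by decide)
  have ua2 : ∀ i, (r a).2 i ≠ 2 := ne_of_card_zero _ 2 (by rw [ca 2]; rfl)
  have ve : ∀ i, (r e).2 i = 2 := fun i =>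
    f4_j _ (ne_of_card_zero _ 0 (by rw [ce 0]; rfl) i) (ne_of_card_zero _ 1 (by rw [ce 1]; rfl) i)
      (ne_of_card_zero _ 3 (by rw [ce 3]; rfl) i)
  obtain ⟨k3, hk3⟩ := exists_of_card_pos _ 3 (by rw [ca 3]; decide)
  obtain ⟨k0, hk0⟩ := exists_of_card_pos _ 0 (by rw [ca 0]; decide)
  -- `g 0 ≤ g (u j)` for every entry `j` of the `{0,1,3}` term
  have g0le : ∀ j, g 0 ≤ g ((r a).2 j) := fun j => by
    have := h8 a a k0 j (by rw [hk0]; exact Fin.zero_le _)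
    rwa [hk0] at this
  by_cases he1 : (r e).1 = 1
  · -- both identity terms: comparable, impossible
    rcases lt_or_gt_of_ne hae with hlt | hlt
    · have hle := h2 a e hlt k3 (by rw [ha1, he1])
      rw [hk3, ve] at hle
      exact absurd hle (by decide)
    · have hle := h2 e a hlt k0 (by rw [ha1, he1])
      rw [hk0, ve] at hle
      exact absurd hle (by decide)
  · obtain ⟨k, i, j, hk, hij, hi, hj, hik, hjk⟩ := carrier_of_ne_one (r e).1 he1 (hinv e)
    rcases lt_or_gt_of_ne hae with hlt | hlt
    · -- D before T: `u k ≤ 2`, so the `3` of `u` sits on the swapped pair; cancellation `g(u i) + g(u j) < 2 g 2`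
      have hle := h2 a e hlt k (by rw [ha1, hk, Equiv.Perm.one_apply])
      rw [ve] at hle
      have hk3k : k3 ≠ k := by
        rintro rfl; rw [hk3] at hle; exact absurd hle (by decide)
      have hC := h6 a e hlt ha1 i j hij hi hj
      rw [ve] at hC
      rcases eq_or_eq_of_ne_third i j k k3 hij hik hjk hk3k with h | h
      · rw [h] at hk3; rw [hk3] at hC; have := g0le j; omega
      · rw [h] at hk3; rw [hk3] at hC; have := g0le i; omega
    · -- T before D: `2 ≤ u k` forces `u k = 3`; cancellation `2 g 2 < g(u i) + g(u j)` with `u i, u j ≤ 2`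
      have hle := h2 e a hlt k (by rw [ha1, hk, Equiv.Perm.one_apply])
      rw [ve] at hle
      have huk : (r a).2 k = 3 := f4_d _ hle (ua2 k)
      have hC := h7 e a hlt ha1 i j hij hi hj
      rw [ve] at hC
      have hi3 : (r a).2 i ≠ 3 := ne_of_card_one _ 3 (by rw [ca 3]; rfl) huk hik
      have hj3 : (r a).2 j ≠ 3 := ne_of_card_one _ 3 (by rw [ca 3]; rfl) huk hjk
      have gi := h8 a e i i (by rw [ve]; exact f4_i _ hi3)
      have gj := h8 a e j j (by rw [ve]; exact f4_i _ hj3)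
      rw [ve] at gi gj
      omega

/-- **Lemma W2** (mirror): if `{0,2,3}` and `{1,1,1}` are both carried then `¬ (g 0 + g 3 < 2·g 1)`. [exchange argument] -/
theorem lemmaW2 {n : ℕ} (r : Fin (n + 1) → Equiv.Perm (Fin 3) × (Fin 3 → Fin 4)) (g : Fin 4 → ℕ)
    (h1 : ∀ k i, (r k).2 ((r k).1 i) = (r k).2 i)
    (hinv : ∀ k i, (r k).1 ((r k).1 i) = i)
    (h2 : ∀ a b : Fin (n + 1), a < b → ∀ i, (r a).1 i = (r b).1 i → (r a).2 i ≤ (r b).2 i)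
    (h6 : ∀ a b : Fin (n + 1), a < b → (r a).1 = 1 → ∀ i j : Fin 3, i ≠ j → (r b).1 i = j → (r b).1 j = i →
      g ((r a).2 i) + g ((r a).2 j) < 2 * g ((r b).2 i))
    (h7 : ∀ a b : Fin (n + 1), a < b → (r b).1 = 1 → ∀ i j : Fin 3, i ≠ j → (r a).1 i = j → (r a).1 j = i →
      2 * g ((r a).2 i) < g ((r b).2 i) + g ((r b).2 j))
    (h8 : ∀ (a b : Fin (n + 1)) (i j : Fin 3), (r a).2 i ≤ (r b).2 j → g ((r a).2 i) ≤ g ((r b).2 j))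
    (hg : g 0 + g 3 < 2 * g 1) : ∀ b e : Fin (n + 1),
    TropicalCensus.classSym (r b) = TropicalCensus.classSym ((1 : Equiv.Perm (Fin 3)), (![0, 2, 3] : Fin 3 → Fin 4)) →
    TropicalCensus.classSym (r e) = TropicalCensus.classSym ((1 : Equiv.Perm (Fin 3)), (![1, 1, 1] : Fin 3 → Fin 4)) → False := by
  intro b e hb he
  have cb : ∀ l, (univ.filter fun i => (r b).2 i = l).card = (![1, 0, 1, 1] : Fin 4 → ℕ) l :=
    fun l => (card_filter_eq_of_classSym_eq hb l).trans (cnt023 l)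
  have ce : ∀ l, (univ.filter fun i => (r e).2 i = l).card = (![0, 3, 0, 0] : Fin 4 → ℕ) l :=
    fun l => (card_filter_eq_of_classSym_eq he l).trans (cnt111 l)
  have hb1 : (r b).1 = 1 := perm_eq_one_of_card_le_one _ (h1 b) fun l => by
    rw [cb l]; fin_cases l <;> decide
  have hbe : b ≠ e := by
    intro h; have := cb 0; rw [h, ce 0] at this; exact absurd this (by decide)
  have wb1 : ∀ i, (r b).2 i ≠ 1 := ne_of_card_zero _ 1 (by rw [cb 1]; rfl)
  have ve : ∀ i, (r e).2 i = 1 := fun i =>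
    f4_k _ (ne_of_card_zero _ 0 (by rw [ce 0]; rfl) i) (ne_of_card_zero _ 2 (by rw [ce 2]; rfl) i)
      (ne_of_card_zero _ 3 (by rw [ce 3]; rfl) i)
  obtain ⟨k3, hk3⟩ := exists_of_card_pos _ 3 (by rw [cb 3]; decide)
  obtain ⟨k0, hk0⟩ := exists_of_card_pos _ 0 (by rw [cb 0]; decide)
  have leg3 : ∀ j, g ((r b).2 j) ≤ g 3 := fun j => by
    have := h8 b b j k3 (by rw [hk3]; exact Fin.le_last _)
    rwa [hk3] at this
  by_cases he1 : (r e).1 = 1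
  · rcases lt_or_gt_of_ne hbe with hlt | hlt
    · have hle := h2 b e hlt k3 (by rw [hb1, he1])
      rw [hk3, ve] at hle
      exact absurd hle (by decide)
    · have hle := h2 e b hlt k0 (by rw [hb1, he1])
      rw [hk0, ve] at hle
      exact absurd hle (by decide)
  · obtain ⟨k, i, j, hk, hij, hi, hj, hik, hjk⟩ := carrier_of_ne_one (r e).1 he1 (hinv e)
    rcases lt_or_gt_of_ne hbe with hlt | hlt
    · -- D before T: `w k ≤ 1` forces `w k = 0`; cancellation `g(w i) + g(w j) < 2 g 1` with `w i, w j ≥ 1`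
      have hle := h2 b e hlt k (by rw [hb1, hk, Equiv.Perm.one_apply])
      rw [ve] at hle
      have hwk : (r b).2 k = 0 := f4_f _ hle (wb1 k)
      have hC := h6 b e hlt hb1 i j hij hi hj
      rw [ve] at hC
      have hi0 : (r b).2 i ≠ 0 := ne_of_card_one _ 0 (by rw [cb 0]; rfl) hwk hik
      have hj0 : (r b).2 j ≠ 0 := ne_of_card_one _ 0 (by rw [cb 0]; rfl) hwk hjk
      have gi := h8 e b i i (by rw [ve]; exact f4_b _ hi0)
      have gj := h8 e b j j (by rw [ve]; exact f4_b _ hj0)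
      rw [ve] at gi gj
      omega
    · -- T before D: `1 ≤ w k`, so the `0` of `w` sits on the swapped pair; cancellation `2 g 1 < g(w i) + g(w j)`
      have hle := h2 e b hlt k (by rw [hb1, hk, Equiv.Perm.one_apply])
      rw [ve] at hle
      have hk0k : k0 ≠ k := by
        rintro rfl; rw [hk0] at hle; exact absurd hle (by decide)
      have hC := h7 e b hlt hb1 i j hij hi hj
      rw [ve] at hC
      rcases eq_or_eq_of_ne_third i j k k0 hij hik hjk hk0k with h | h
      · rw [h] at hk0; rw [hk0] at hC; have := leg3 j; omega
      · rw [h] at hk0; rw [hk0] at hC; have := leg3 i; omega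

/-! ## Lemma Z: the parity obstruction -/

/-- three pairwise distinct elements exhaust `Fin 3`. -/
theorem univ_three_of_ne : ∀ κ0 κ1 κ2 : Fin 3, κ0 ≠ κ1 → κ0 ≠ κ2 → κ1 ≠ κ2 →
    (univ : Finset (Fin 3)) = {κ0, κ1, κ2} := by decide

/-- a product over `Fin 3` listed along any three distinct indices. -/
theorem prod_three_perm (F : Fin 3 → ℤ) (κ0 κ1 κ2 : Fin 3) (h01 : κ0 ≠ κ1) (h02 : κ0 ≠ κ2) (h12 : κ1 ≠ κ2) :
    ∏ k, F k = F κ0 * F κ1 * F κ2 := by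
  rw [univ_three_of_ne κ0 κ1 κ2 h01 h02 h12, prod_insert (by simp [h01, h02]), prod_insert (by simp [h12]),
    prod_singleton, mul_assoc]

/-- **Lemma Z (parity).**  Abstract sign data: `s a` is the sign of the `a`-th term, `A k c` the sign of the diagonal letter of rank `c` at
column `k`; an identity term has sign `∏_k A k (u k)` (`hD`), a crossing term fixing column `k` has the sign of `−A k (rank at k)` (`hT`), and
consecutive signs alternate (`halt`).  Then an identity term `D(u)` followed IMMEDIATELY by three crossing terms fixing the three columns
`κ2, κ0, κ1` with the ranks of `u` there is impossible: the product of the four signs is `−(∏_k A k (u k))² · (…)² < 0`, while four consecutive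
alternating signs have positive product. [the parity certificate of the cell's 17-term chains] -/
theorem parity {n : ℕ} (r : Fin (n + 1) → Equiv.Perm (Fin 3) × (Fin 3 → Fin 4)) (s : Fin (n + 1) → ℤ) (A : Fin 3 → Fin 4 → ℤ)
    (hD : ∀ a, (r a).1 = 1 → s a = ∏ k, A k ((r a).2 k))
    (hT : ∀ (a : Fin (n + 1)) (k : Fin 3), (r a).1 ≠ 1 → (r a).1 k = k → ∀ t : ℤ, s a * t < 0 ↔ -A k ((r a).2 k) * t < 0)
    (halt : ∀ k : Fin n, s k.castSucc * s k.succ < 0)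
    (a₀ c f e : Fin (n + 1)) (hcv : (c : ℕ) = a₀ + 1) (hfv : (f : ℕ) = a₀ + 2) (hev : (e : ℕ) = a₀ + 3)
    (ha1 : (r a₀).1 = 1) (κ0 κ1 κ2 : Fin 3) (hκ01 : κ0 ≠ κ1) (hκ02 : κ0 ≠ κ2) (hκ12 : κ1 ≠ κ2)
    (hcT : (r c).1 ≠ 1 ∧ (r c).1 κ2 = κ2 ∧ (r c).2 κ2 = (r a₀).2 κ2)
    (hfT : (r f).1 ≠ 1 ∧ (r f).1 κ0 = κ0 ∧ (r f).2 κ0 = (r a₀).2 κ0)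
    (heT : (r e).1 ≠ 1 ∧ (r e).1 κ1 = κ1 ∧ (r e).2 κ1 = (r a₀).2 κ1) : False := by
  have hen : (e : ℕ) < n + 1 := e.isLt
  -- the three alternations inside the window
  have alt : ∀ (x y : Fin (n + 1)), (y : ℕ) = x + 1 → s x * s y < 0 := by
    intro x y hxy
    have hx : (x : ℕ) < n := by have := y.isLt; omega
    have := halt ⟨x, hx⟩
    have e1 : (⟨(x : ℕ), hx⟩ : Fin n).castSucc = x := Fin.ext rfl
    have e2 : (⟨(x : ℕ), hx⟩ : Fin n).succ = y := Fin.ext (by simp [hxy])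
    rwa [e1, e2] at this
  have h01 := alt a₀ c hcv
  have h23 := alt f e (by omega)
  set Q0 := A κ0 ((r a₀).2 κ0) with hQ0
  set Q1 := A κ1 ((r a₀).2 κ1) with hQ1
  set Q2 := A κ2 ((r a₀).2 κ2) with hQ2
  have hP : s a₀ = Q0 * Q1 * Q2 := by
    rw [hD a₀ ha1, hQ0, hQ1, hQ2]
    exact prod_three_perm (fun k => A k ((r a₀).2 k)) κ0 κ1 κ2 hκ01 hκ02 hκ12
  obtain ⟨hc1, hcκ, hc2⟩ := hcT
  obtain ⟨hf1, hfκ, hf2⟩ := hfT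
  obtain ⟨he1, heκ, he2⟩ := heT
  have tc := hT c κ2 hc1 hcκ
  have tf := hT f κ0 hf1 hfκ
  have te := hT e κ1 he1 heκ
  rw [hc2] at tc; rw [hf2] at tf; rw [he2] at te
  -- `s a₀ · s c < 0`  ⇒  `Q2² · (Q0 Q1) > 0`
  have i1 : -Q2 * s a₀ < 0 := (tc (s a₀)).mp (by rw [mul_comm]; exact h01)
  -- `s f · s e < 0`  ⇒  `Q0 · Q1 < 0` (the crossing term in between is not even needed)
  have i3 : -Q1 * -Q0 < 0 := (te (-Q0)).mp (by
    have := (tf (s e)).mp h23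
    rw [mul_comm]; exact this)
  rw [hP] at i1
  nlinarith [sq_nonneg Q2, i1, i3]

end SymmetricThreeFourFifteen

end Summit.ValiantsHypothesis.ValiantsHypothesis.Theorems.KPlusLogSqLaw
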